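import Literature.IUT.HodgeTheaters.TemperedCoveringsChartsAt
import Literature.IUT.HodgeTheaters.TemperedCoveringsProTreeCountable
import HarnessLib

/-!
# [IUTchI] Prop. 2.1 / Prop. 2.2 on a tempered fundamental group CHART, Thm 3.7 (iii) AT `𝒢` — WITHOUT (RF)

Mochizuki, *Inter-universal Teichmüller theory I*, kurims manuscript (May 2020), §2, Proposition 2.1
and Proposition 2.2, p. 45 [cite: Mochizuki2012, Prop 2.1 p.45] (D-0012 claim key; series status
DISPUTED; nothing of the series is asserted here).

PROOF-ONLY companion of `TemperedCoveringsChartsAt.lean` (φ2 programme, abc-iut-L3-d1 /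
abc-iut-L5-t11): the per-graph forms `prop21_of_chart_at` / `tp_isCommensurablyTerminal_of_chart_at`
(inputs `CompactInVerticialAt 𝒢`, a chart `e : Π^tp_𝔾 ≃ₜ* π₁^temp(𝒢)`, node data, (A3)) with the
binder (RF) ("open normal subgroups of `Π^tp_𝔾` closed for the `Π̂_𝔾`-topology are cofinal") REMOVED:
step (A0) now comes from Galois-countability of the chart (`TemperedPiChart.secondCountableTopology`)
through `IsTempered.isCompact_comap_of_firstCountable` (open mapping theorem for tempered groups,
`SemiGraphs/TemperedOpenMapping.lean`, `TemperedCompactPreimageCountable.lean`).  Nothing in the parent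
files is edited.  Typed ≠ proved; nothing here bears on [IUTchIII] Cor. 3.12.
-/

namespace Literature.IUT.HodgeTheaters

open Pointwise Filter
open _root_.Topology
open Literature.AnabelianGeometry.SemiGraphs (IsTempered ProfiniteSemiGraph)
open Literature.AnabelianGeometry.SemiGraphs.ProfiniteSemiGraph (TemperedPiChart verticialSubgroups
  CompactInVerticialAt VerticialInjective)
open Literature.AnabelianGeometry.AbsoluteAnabelian (IsCommensurablyTerminal)

universe u

namespace TemperedGraphGroupData

variable (D : TemperedGraphGroupData.{u}) {𝒢 : ProfiniteSemiGraph.{u}}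

/-- **[IUTchI] Proposition 2.1 for `D` with `Π^tp_𝔾` a chart of `𝒢`, Thm 3.7 (iii) AT `𝒢`, NO (RF)
binder**: as `prop21_of_chart_at`, with (A0) from the chart's Galois-countability.
([IUTchI] Prop 2.1 p.45) [claim: Mochizuki2012, status: disputed] -/
theorem prop21_of_chart_at' [T2Space D.Hat] (c : TemperedPiChart 𝒢) (e : D.Tp ≃ₜ* c.G)
    (h𝒢 : 𝒢.Thm37Hypotheses) (hCV : CompactInVerticialAt 𝒢)
    (Λv : 𝒢.graph.Vertex → Subgroup D.Tp)
    (hΛv : ∀ v, (Λv v).map (e : D.Tp →* c.G) ∈ verticialSubgroups c v)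
    {E : Type*} (src tgt : E → 𝒢.graph.Vertex) (c₁ c₂ : E → D.Tp)
    (hA3 : ∀ (v w : 𝒢.graph.Vertex) (g h : D.Hat),
      MulAut.conj g • (Λv v).map D.ι ⊓ MulAut.conj h • (Λv w).map D.ι ≠ ⊥ →
        (v = w ∧ g⁻¹ * h ∈ (Λv v).map D.ι) ∨
        ∃ (e : E) (k : D.Hat), ∃ p ∈ (Λv (src e)).map D.ι, ∃ q ∈ (Λv (tgt e)).map D.ι,
          (src e = v ∧ tgt e = w ∧ g = k * D.ι (c₁ e) * p ∧ h = k * D.ι (c₂ e) * q) ∨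
          (src e = w ∧ tgt e = v ∧ h = k * D.ι (c₁ e) * p ∧ g = k * D.ι (c₂ e) * q)) :
    D.ProfiniteConjugatesOfCompactSubgroups := by
  haveI := c.secondCountableTopology
  haveI : SecondCountableTopology D.Tp := e.toHomeomorph.secondCountableTopology
  exact D.prop21_of_cosetTree_of_firstCountable (D.isTempered_tp_of_chart c e) Λv src tgt c₁ c₂
    (fun Λ hΛc _ => D.conj_le_of_compactInVerticial_at c e h𝒢 hCV Λv hΛv Λ hΛc) hA3

/-- **[IUTchI] Proposition 2.2 ("`Π^tp_𝔾` commensurably terminal in `Π̂_𝔾`") with `Π^tp_𝔾` a chart of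
`𝒢`, Thm 3.7 (iii) AT `𝒢`, NO (RF) binder**: as `tp_isCommensurablyTerminal_of_chart_at`.
([IUTchI] Prop 2.2 p.45) [claim: Mochizuki2012, status: disputed] -/
theorem tp_isCommensurablyTerminal_of_chart_at' [T2Space D.Hat] (c : TemperedPiChart 𝒢)
    (e : D.Tp ≃ₜ* c.G) (h𝒢 : 𝒢.Thm37Hypotheses)
    (hCV : CompactInVerticialAt 𝒢) (hVI : VerticialInjective.{u})
    (Λv : 𝒢.graph.Vertex → Subgroup D.Tp)
    (hΛv : ∀ v, (Λv v).map (e : D.Tp →* c.G) ∈ verticialSubgroups c v)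
    {E : Type*} (src tgt : E → 𝒢.graph.Vertex) (c₁ c₂ : E → D.Tp)
    (hA3 : ∀ (v w : 𝒢.graph.Vertex) (g h : D.Hat),
      MulAut.conj g • (Λv v).map D.ι ⊓ MulAut.conj h • (Λv w).map D.ι ≠ ⊥ →
        (v = w ∧ g⁻¹ * h ∈ (Λv v).map D.ι) ∨
        ∃ (e : E) (k : D.Hat), ∃ p ∈ (Λv (src e)).map D.ι, ∃ q ∈ (Λv (tgt e)).map D.ι,
          (src e = v ∧ tgt e = w ∧ g = k * D.ι (c₁ e) * p ∧ h = k * D.ι (c₂ e) * q) ∨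
          (src e = w ∧ tgt e = v ∧ h = k * D.ι (c₁ e) * p ∧ g = k * D.ι (c₂ e) * q)) :
    IsCommensurablyTerminal D.ι.range := by
  haveI := c.secondCountableTopology
  haveI : SecondCountableTopology D.Tp := e.toHomeomorph.secondCountableTopology
  obtain ⟨v₀, hv₀c, hv₀inf⟩ := D.exists_infinite_compact_of_chart c e h𝒢 hVI Λv hΛv
  exact D.tp_isCommensurablyTerminal_of_cosetTree_of_firstCountable (D.isTempered_tp_of_chart c e)
    Λv src tgt c₁ c₂ (fun Λ hΛc _ => D.conj_le_of_compactInVerticial_at c e h𝒢 hCV Λv hΛv Λ hΛc)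
    hA3 v₀ hv₀c hv₀inf

end TemperedGraphGroupData

end Literature.IUT.HodgeTheaters
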